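import Mathlib
import Literature.NumberTheory.Transcendental.AndreCriterionAnalyticProofs
import Literature.Analysis.Complex.AnalyticFormalRoots
import HarnessLib

/-!
# Norm-halving model space — piece (N1) `stubN_cauchyCoeff`:
# Cauchy's estimate for the Taylor coefficients of `b / a`

Crux `PriceOfContractivity` (stmt-ValiantsHypothesis-10583), line `registered`, piece N1 of the
unconditional profile-`(n,1)` case of the norm-halving stub.

Let `a, b ∈ ℂ[ξ]` with `a(0) = 1`, `a(ξ) ≠ 0` and `|b(ξ)| ≤ M |a(ξ)|` on the closed disc `|ξ| ≤ 2`.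
Then the `k`-th coefficient of the formal power series `b · a⁻¹ ∈ ℂ⟦ξ⟧` has modulus at most
`M / 2ᵏ`.  Proof: `g = b/a` is holomorphic on a neighbourhood of the closed disc, its Taylor
series at `0` is `𝓣[g]` with `â · 𝓣[g] = 𝓣[a · g] = 𝓣[b] = b̂` (multiplicativity of Taylor
series of analytic germs, `Literature…AndreCriterion.taylor_mul`, and `𝓣[P] = P` for a
polynomial, `Literature…FormalRoot.taylor_polynomial`), so `𝓣[g] = b̂ · â⁻¹` (`â(0) = 1`);
Cauchy's estimate on the circle `|ξ| = 2` (`Literature…AndreCriterion.norm_coeff_taylor_le`,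
from Mathlib's `Complex.norm_iteratedDeriv_le_of_forall_mem_sphere_norm_le`) gives
`|[ξᵏ] 𝓣[g]| ≤ (sup_{|ξ|=2} |g|) / 2ᵏ ≤ M / 2ᵏ`.  All folklore.
-/

noncomputable section

-- `Summit.<Summit>.<Problem>` repeats `ValiantsHypothesis` by the tree's layout convention (D-0017).
set_option linter.dupNamespace false

namespace Summit.ValiantsHypothesis.ValiantsHypothesis.Theorems.PriceOfContractivity.NormHalvingModelSpace

open Metric Filter
open scoped Topology

open Literature.NumberTheory.Transcendental.AndreCriterion (taylor_congr taylor_mul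
  norm_coeff_taylor_le)
open Literature.Analysis.Complex.FormalRoot (taylor_polynomial)

/-- **Piece (N1): Cauchy's estimate for the Taylor coefficients of `b / a`.**  If `a(0) = 1`,
`a` has no zero in the closed disc `|ξ| ≤ 2` and `|b| ≤ M |a|` there, then the `k`-th coefficient
of the power series `b · a⁻¹` has modulus at most `M / 2ᵏ`. [folklore] -/
theorem stubN_cauchyCoeff :
    ∀ (a b : Polynomial ℂ) (M : ℝ), a.coeff 0 = 1 →
      (∀ ξ : ℂ, ‖ξ‖ ≤ 2 → a.eval ξ ≠ 0) →
      (∀ ξ : ℂ, ‖ξ‖ ≤ 2 → ‖b.eval ξ‖ ≤ M * ‖a.eval ξ‖) →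
      ∀ k : ℕ, ‖PowerSeries.coeff k ((b : PowerSeries ℂ) * (a : PowerSeries ℂ)⁻¹)‖ ≤ M / 2 ^ k := by
  intro a b M ha0 hane hbM k
  -- the holomorphic function `g = b / a` on the closed disc `|ξ| ≤ 2`
  set g : ℂ → ℂ := fun ξ => b.eval ξ / a.eval ξ with hg
  have hgd : DifferentiableOn ℂ g (closedBall (0 : ℂ) 2) := fun ξ hξ =>
    ((b.differentiableAt).div (a.differentiableAt)
      (hane ξ (by simpa using hξ))).differentiableWithinAt
  have hga : AnalyticAt ℂ g 0 := hgd.analyticAt (closedBall_mem_nhds (0 : ℂ) two_pos)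
  have hfa : AnalyticAt ℂ (fun ξ : ℂ => a.eval ξ) 0 := a.differentiable.analyticAt 0
  -- `a · g = b` near `0`
  have hev : ((fun ξ : ℂ => a.eval ξ) * g) =ᶠ[𝓝 (0 : ℂ)] (fun ξ : ℂ => b.eval ξ) := by
    filter_upwards [closedBall_mem_nhds (0 : ℂ) two_pos] with ξ hξ
    have hξ' : a.eval ξ ≠ 0 := hane ξ (by simpa using hξ)
    simp only [Pi.mul_apply, hg]
    field_simp
  -- hence `â · 𝓣[g] = b̂`, i.e. `𝓣[g] = b̂ · â⁻¹`
  have hmul : (a : PowerSeries ℂ) *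
      (PowerSeries.mk fun n => ((Nat.factorial n : ℂ)⁻¹ * iteratedDeriv n g 0)) =
        (b : PowerSeries ℂ) := by
    rw [← taylor_polynomial a, ← taylor_polynomial b, ← taylor_mul hfa hga, taylor_congr hev]
  have hca : PowerSeries.constantCoeff (a : PowerSeries ℂ) ≠ 0 := by
    rw [Polynomial.constantCoeff_coe, ha0]
    exact one_ne_zero
  have hT : (PowerSeries.mk fun n => ((Nat.factorial n : ℂ)⁻¹ * iteratedDeriv n g 0)) =
      (b : PowerSeries ℂ) * (a : PowerSeries ℂ)⁻¹ := by
    rw [PowerSeries.eq_mul_inv_iff_mul_eq hca, mul_comm]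
    exact hmul
  -- Cauchy's estimate on the circle `|ξ| = 2`
  have hdc : DiffContOnCl ℂ g (ball (0 : ℂ) 2) := hgd.diffContOnCl_ball le_rfl
  have hbd : ∀ z ∈ sphere (0 : ℂ) 2, ‖g z‖ ≤ M := by
    intro z hz
    have hz2 : ‖z‖ ≤ 2 := by simpa using le_of_eq (mem_sphere_zero_iff_norm.mp hz)
    have haz : 0 < ‖a.eval z‖ := norm_pos_iff.mpr (hane z hz2)
    simp only [hg, norm_div]
    rw [div_le_iff₀ haz]
    exact hbM z hz2
  rw [← hT]
  exact norm_coeff_taylor_le two_pos hdc hbd k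

end Summit.ValiantsHypothesis.ValiantsHypothesis.Theorems.PriceOfContractivity.NormHalvingModelSpace
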